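import Mathlib
import HarnessLib
import Summits.ValiantsHypothesis.ValiantsHypothesis.Theses.MonotoneRestoration
import Literature.Computability.AlgebraicComplexity.ArithCircuit
import Literature.Computability.AlgebraicComplexity.ArithCircuitProofs
import Literature.Computability.AlgebraicComplexity.MonotoneStructure
import Literature.Computability.AlgebraicComplexity.PermanentIrreducible
import Literature.ModelTheory.FiniteModelTheory.CkEquiv
import Summits.ValiantsHypothesis.ValiantsHypothesis.Theorems.MonotoneRestorationMonotoneRestorationQPCosetCount
import Summits.ValiantsHypothesis.ValiantsHypothesis.Theorems.MonotoneRestorationMonotoneRestorationQPSymmetricLB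
import Summits.ValiantsHypothesis.ValiantsHypothesis.Theorems.MonotoneRestorationMonotoneRestorationQPSupportSymmetrisation
import Summits.ValiantsHypothesis.ValiantsHypothesis.Theorems.MonotoneRestorationMonotoneRestorationQPSparseRegime
import Summits.ValiantsHypothesis.ValiantsHypothesis.Theorems.MonotoneRestorationMonotoneRestorationQPBeta
import Literature.Computability.AlgebraicComplexity.SymmetricArithCircuit
import Literature.Computability.AlgebraicComplexity.DawarWilsenach2025Proofs
import Literature.GroupTheory.PermutationGroups.SmallIndexSubgroups
import Summits.ValiantsHypothesis.ValiantsHypothesis.Theorems.MonotoneRestorationQP.Negative.LoadBearing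
import Summits.ValiantsHypothesis.ValiantsHypothesis.Theorems.MonotoneRestorationMonotoneRestorationQPPermSupportCount
import Literature.Computability.AlgebraicComplexity.CircuitDepthProofs
import Literature.Barriers.ValiantsHypothesis.MonotoneGapParseTrees
import Summits.ValiantsHypothesis.ValiantsHypothesis.Theorems.MonotoneRestorationMonotoneRestorationQPEsymmRowSumsStructure
import Summits.ValiantsHypothesis.ValiantsHypothesis.Theorems.MonotoneRestorationMonotoneRestorationQPMonotoneFormulaCount

/-! TTRL-lite variant V20269 of stmt-ValiantsHypothesis-15886 -/

/-!
# Monotone formula lower bounds III — `e_{⌊n/2⌋}` of the row sums (file 3/3)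

The TTRL-lite variant V20269 of `stub_esymmRowSums_complexity` (crux `MonotoneRestorationQP`,
item `stmt-ValiantsHypothesis-15886`) replaces circuit complexity by formula complexity
(`formulaComplexity`, `CircuitDepth.lean`); over `ℝ≥0` this is *monotone* formula size, and the
statement is FALSE: `stub_esymmRowSums_complexity_var20269_false`.

* `container_bound`: a chain product with row-multilinear monomials has few row sets
  (`N² · ∏ (d_j + 1) ≤ 4^n`: pairwise row-disjoint factors, `binom(r, d)² (d + 1) ≤ 4^r`).
* `exists_rows_eq`: every `k`-set of rows is the row set of a monomial of `e_k(R₁, …, R_n)`.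
* The refutation: with `T = 4c₀ + 6`, `k = 9^T`, `n = 2k`, a formula of size `≤ (n + 2)^{c₀}`
  gives `≤ 3 (n + 2)^{c₀} + 1` chains (`good_eval`), each covering `N` row sets with
  `N² 3^{T²} ≤ 4^n`, against `binom(2k, k) ≥ 4^k / (2k + 1)` row sets to cover.

References: [HrubesYehudayoffHomogeneous2011] P. Hrubeš, A. Yehudayoff, *Homogeneous formulas and
symmetric polynomials*, Comput. Complexity 20 (2011), Thm. 1 and its monotone corollary;
[ShamirSnir1980] E. Shamir, M. Snir, *On the depth complexity of formulas*, MST 13 (1980).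
-/

-- `Summit.ValiantsHypothesis.ValiantsHypothesis.…` is the tree's single-conjunct layout (Sub = Summit).
set_option linter.dupNamespace false

noncomputable section

namespace Summit.ValiantsHypothesis.ValiantsHypothesis.Theorems

open Summit.ValiantsHypothesis.ValiantsHypothesis.Theses.MonotoneRestoration
open Literature.Computability.AlgebraicComplexity
open MvPolynomial ArithCircuit
open Literature.Barriers.ValiantsHypothesis.JerrumSnir
open scoped NNReal Pointwise

namespace MonotoneFormulaLB

/-- `Hom[f, d]`: every monomial of `f` has degree `d` (local notation). -/
local notation3 "Hom[" f ", " d "]" =>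
  ∀ m ∈ MvPolynomial.support f, Finsupp.degree m = (d : ℕ)

/-! ### Rows of monomials in the matrix variables `x_{i,j}` -/

section Rows

variable {n : ℕ}

/-- **The container bound.** If the product `C 0 ⋯ C T` of nonzero polynomials, `C j`
homogeneous of degree `d j`, has only row-multilinear monomials, then the number of row sets of
its monomials `N` satisfies `N² · ∏ (d j + 1) ≤ 4^n`: the factors have pairwise disjoint row
sets `R_j` (`Σ |R_j| ≤ n`), a row set is a union of `d j`-subsets of the `R_j`, and
`binom(r, d)² (d + 1) ≤ 4^r`. [cite: HrubesYehudayoffHomogeneous2011, Thm. 1 (monotone corollary)] -/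
theorem container_bound (T : ℕ) (C : ℕ → MvPolynomial (Fin n × Fin n) ℝ≥0) (d : ℕ → ℕ)
    (hd : ∀ j, j ≤ T → Hom[C j, d j]) (hne : ∀ j, j ≤ T → C j ≠ 0)
    (hml : ∀ m ∈ (∏ j ∈ Finset.range (T + 1), C j).support, ∀ i, rowDegrees m i ≤ 1) :
    ((∏ j ∈ Finset.range (T + 1), C j).support.image
        fun m => (rowDegrees m).support).card ^ 2 *
      ∏ j ∈ Finset.range (T + 1), (d j + 1) ≤ 4 ^ n := by
  classical
  -- row sets of the factors
  set R : Fin (T + 1) → Finset (Fin n) :=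
    fun j => ((C j).support).biUnion fun a => (rowDegrees a).support with hR
  -- a default monomial in each factor
  have hb : ∀ j : ℕ, ∃ b : Fin n × Fin n →₀ ℕ, j ≤ T → b ∈ (C j).support := fun j => by
    by_cases hj : j ≤ T
    · obtain ⟨b, hb⟩ := support_nonempty.2 (hne j hj); exact ⟨b, fun _ => hb⟩
    · exact ⟨0, fun h => absurd h hj⟩
  choose b hb using hb
  -- (1) pairwise disjointness of the row sets
  have hdisj : ∀ j₁ j₂ : Fin (T + 1), j₁ ≠ j₂ → Disjoint (R j₁) (R j₂) := by
    intro j₁ j₂ hne12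
    rw [Finset.disjoint_left]
    intro i hi₁ hi₂
    simp only [hR, Finset.mem_biUnion] at hi₁ hi₂
    obtain ⟨a₁, ha₁, hi₁⟩ := hi₁
    obtain ⟨a₂, ha₂, hi₂⟩ := hi₂
    set a : ℕ → Fin n × Fin n →₀ ℕ :=
      Function.update (Function.update b (j₁ : ℕ) a₁) (j₂ : ℕ) a₂ with ha
    have hv : (j₁ : ℕ) ≠ (j₂ : ℕ) := fun h => hne12 (Fin.ext h)
    have haj₁ : a j₁ = a₁ := by
      rw [ha, Function.update_of_ne hv, Function.update_self]
    have haj₂ : a j₂ = a₂ := by rw [ha, Function.update_self]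
    have hmem : ∀ j, j ≤ T → a j ∈ (C j).support := by
      intro j hj
      by_cases h2 : j = (j₂ : ℕ)
      · subst h2; rw [haj₂]; exact ha₂
      by_cases h1 : j = (j₁ : ℕ)
      · subst h1; rw [haj₁]; exact ha₁
      rw [ha, Function.update_of_ne h2, Function.update_of_ne h1]
      exact hb j hj
    have hm : ∑ j ∈ Finset.range (T + 1), a j ∈ (∏ j ∈ Finset.range (T + 1), C j).support :=
      (mem_support_prod_range C T _).2 ⟨a, hmem, rfl⟩
    have h1 := hml _ hm i
    rw [rowDegrees_sum_apply] at h1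
    have hpair : ({(j₁ : ℕ), (j₂ : ℕ)} : Finset ℕ) ⊆ Finset.range (T + 1) := by
      intro j hj
      simp only [Finset.mem_insert, Finset.mem_singleton] at hj
      rw [Finset.mem_range]
      rcases hj with rfl | rfl
      exacts [j₁.isLt, j₂.isLt]
    have h2 := Finset.sum_le_sum_of_subset (f := fun j => rowDegrees (a j) i) hpair
    rw [Finset.sum_pair hv, haj₁, haj₂] at h2
    have e₁ := Finsupp.mem_support_iff.1 hi₁
    have e₂ := Finsupp.mem_support_iff.1 hi₂
    omega
  -- hence `Σ |R_j| ≤ n`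
  have hsumR : ∑ j : Fin (T + 1), (R j).card ≤ n := by
    rw [← Finset.card_biUnion fun j₁ _ j₂ _ h => hdisj j₁ j₂ h]
    exact (Finset.card_le_univ _).trans (by simp)
  -- (2) every row set is a union of `d j`-subsets of the `R_j`
  have himg : ((∏ j ∈ Finset.range (T + 1), C j).support.image
      fun m => (rowDegrees m).support) ⊆
      (Fintype.piFinset fun j : Fin (T + 1) => Finset.powersetCard (d j) (R j)).image
        fun S => Finset.univ.biUnion S := by
    intro X hX
    obtain ⟨m, hm, rfl⟩ := Finset.mem_image.1 hX
    obtain ⟨a, ha, rfl⟩ := (mem_support_prod_range C T m).1 hm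
    refine Finset.mem_image.2 ⟨fun j => (rowDegrees (a j)).support, ?_, ?_⟩
    · rw [Fintype.mem_piFinset]
      intro j
      rw [Finset.mem_powersetCard]
      refine ⟨fun i hi => Finset.mem_biUnion.2 ⟨a j, ha j (Nat.lt_succ_iff.1 j.isLt), hi⟩, ?_⟩
      rw [card_rows_eq_degree, hd j (Nat.lt_succ_iff.1 j.isLt) _ (ha j (Nat.lt_succ_iff.1 j.isLt))]
      intro i
      refine le_trans ?_ (hml _ hm i)
      rw [rowDegrees_sum_apply]
      exact Finset.single_le_sum (f := fun l => rowDegrees (a l) i) (fun _ _ => Nat.zero_le _)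
        (Finset.mem_range.2 j.isLt)
    · rw [rows_sum]
      ext i
      simp only [Finset.mem_biUnion, Finset.mem_univ, true_and, Finset.mem_range]
      constructor
      · rintro ⟨j, hj⟩; exact ⟨j, j.isLt, hj⟩
      · rintro ⟨j, hj, hij⟩; exact ⟨⟨j, hj⟩, hij⟩
  have hcard : ((∏ j ∈ Finset.range (T + 1), C j).support.image
      fun m => (rowDegrees m).support).card ≤ ∏ j : Fin (T + 1), (R j).card.choose (d j) := by
    refine (Finset.card_le_card himg).trans (Finset.card_image_le.trans ?_)
    rw [Fintype.card_piFinset]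
    exact le_of_eq (Finset.prod_congr rfl fun j _ => Finset.card_powersetCard _ _)
  -- (3) the binomial estimate
  calc ((∏ j ∈ Finset.range (T + 1), C j).support.image
          fun m => (rowDegrees m).support).card ^ 2 * ∏ j ∈ Finset.range (T + 1), (d j + 1)
      ≤ (∏ j : Fin (T + 1), (R j).card.choose (d j)) ^ 2 * ∏ j : Fin (T + 1), (d j + 1) := by
        rw [← Fin.prod_univ_eq_prod_range (fun j => d j + 1) (T + 1)]
        exact Nat.mul_le_mul_right _ (Nat.pow_le_pow_left hcard 2)
    _ ≤ 4 ^ ∑ j : Fin (T + 1), (R j).card :=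
        prod_choose_sq_mul_le Finset.univ (fun j => (R j).card) (fun j => d j)
    _ ≤ 4 ^ n := Nat.pow_le_pow_right (by norm_num) hsumR

/-- Every `k`-set of rows is the row set of a monomial of `e_k(R₁, …, R_n)`: the monomial
`∏_{i ∈ S} x_{i, j₀}`. [folklore] -/
theorem exists_rows_eq (k : ℕ) (j₀ : Fin n) (S : Finset (Fin n)) (hS : S.card = k) :
    ∃ m ∈ (bind₁ (fun i : Fin n => ∑ j : Fin n, (X (i, j) : MvPolynomial (Fin n × Fin n) ℝ≥0))
        (esymm (Fin n) ℝ≥0 k)).support, (rowDegrees m).support = S := by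
  classical
  refine ⟨∑ i ∈ S, Finsupp.single (i, j₀) 1, ?_, ?_⟩
  · have hprod : ∀ t : Finset (Fin n), ∑ i ∈ t, Finsupp.single (i, j₀) 1 ∈
        (∏ i ∈ t, ∑ j : Fin n, (X (i, j) : MvPolynomial (Fin n × Fin n) ℝ≥0)).support := by
      intro t
      induction t using Finset.induction_on with
      | empty =>
        rw [Finset.sum_empty, Finset.prod_empty, support_one]
        exact Finset.mem_singleton_self _
      | insert a t ha ih =>
        rw [Finset.sum_insert ha, Finset.prod_insert ha, support_mul_eq]
        refine Finset.add_mem_add ?_ ih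
        rw [mem_support_iff]
        refine ne_of_gt (lt_of_lt_of_le ?_ (coeff_le_coeff_sum Finset.univ
          (fun j => (X (a, j) : MvPolynomial (Fin n × Fin n) ℝ≥0)) (Finset.mem_univ j₀) _))
        rw [MvPolynomial.coeff_X, if_pos rfl]
        exact zero_lt_one' ℝ≥0
    rw [esymmRowSumsStructure_eq_sum, mem_support_iff]
    refine ne_of_gt (lt_of_lt_of_le ?_ (coeff_le_coeff_sum (Finset.powersetCard k Finset.univ)
      (fun t => ∏ i ∈ t, ∑ j : Fin n, (X (i, j) : MvPolynomial (Fin n × Fin n) ℝ≥0))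
      (Finset.mem_powersetCard.2 ⟨Finset.subset_univ S, hS⟩) _))
    exact pos_iff_ne_zero.2 (mem_support_iff.1 (hprod S))
  · rw [rows_sum]
    ext i
    simp only [rowDegrees_single, Finset.mem_biUnion, Finsupp.support_single _ one_ne_zero,
      Finset.mem_singleton]
    constructor
    · rintro ⟨i', hi', rfl⟩; exact hi'
    · intro hi; exact ⟨i, hi, rfl⟩

end Rows

end MonotoneFormulaLB

open MonotoneFormulaLB in
/-- **TTRL-lite variant V20269 of `stub_esymmRowSums_complexity` is false**: the formula
complexity of `e_{⌊n/2⌋}(R₁, …, R_n)` over `ℝ≥0` (i.e. its *monotone* formula size) is not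
polynomially bounded — it is `n^{Ω(log n)}` (Shamir–Snir 1980; Hrubeš–Yehudayoff 2011, via the
log-product decomposition of homogeneous formulas). Proof: over `ℝ≥0` nothing cancels, so a
fan-in-two formula of size `E` yields a cover of the monomials of its (homogeneous) value by
`3E + 1` log-product chains (`good_eval`); each chain covers at most `binom`-few row sets
(`container_bound`), while all `binom(n, n/2)` half-size row sets occur; with `n = 2 · 9^T`,
`T = 4c₀ + 6` this contradicts `E ≤ (n + 2)^{c₀}`.
[cite: HrubesYehudayoffHomogeneous2011, Thm. 1 (monotone corollary)] -/
theorem stub_esymmRowSums_complexity_var20269_false :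
    ¬ (∃ c₀ : ℕ, ∀ n : ℕ, formulaComplexity (MvPolynomial.bind₁
      (fun i : Fin n => ∑ j : Fin n, MvPolynomial.X (i, j))
        (MvPolynomial.esymm (Fin n) NNReal (n / 2))) ≤ (n + 2) ^ c₀) := by
  classical
  rintro ⟨c₀, hc⟩
  -- parameters: depth `T`, degree `k = 9^T`, size `n = 2k`
  set T : ℕ := 4 * c₀ + 6 with hT
  have hT1 : 1 ≤ T := by omega
  set k : ℕ := 9 ^ T with hk
  have h3T1 : (3 : ℕ) ≤ 3 ^ T := by
    calc (3 : ℕ) = 3 ^ 1 := by norm_num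
      _ ≤ 3 ^ T := Nat.pow_le_pow_right (by norm_num) hT1
  have h9 : (9 : ℕ) ^ T = 3 ^ T * 3 ^ T := by rw [← mul_pow]; norm_num
  have h3T : 3 * 3 ^ T ≤ k := by rw [hk, h9]; exact Nat.mul_le_mul_right _ h3T1
  have hk9 : 9 ≤ k := by nlinarith
  set n : ℕ := 2 * k with hn
  have hnk : n / 2 = k := by omega
  have hcn := hc n
  rw [hnk] at hcn
  set P := MvPolynomial.bind₁ (fun i : Fin n => ∑ j : Fin n, MvPolynomial.X (i, j))
    (MvPolynomial.esymm (Fin n) NNReal k) with hP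
  -- an optimal formula and the covering property of its value
  obtain ⟨Q, hQF, hQ2, hQc, hQs⟩ :=
    ArithCircuit.exists_computes_size_eq_formulaComplexity (k := ℝ≥0) P
  have hgood := good_eval Q hQF hQ2
  rw [show Q.eval = P from hQc, hQs] at hgood
  -- structure of `P`
  have hP0 : P ≠ 0 := esymmRowSumsStructure_ne_zero n k (by omega)
  have hPhom : ∀ m ∈ P.support, Finsupp.degree m = k := fun m hm => by
    have h := esymmRowSumsStructure_isHomogeneous n k (mem_support_iff.1 hm)
    rw [Finsupp.degree_eq_weight_one]
    exact h
  have hPml := esymmRowSumsStructure_rowDegrees_le n k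
  -- the cover at depth `T`, degree `k`, threshold `⌊2k/3⌋`
  obtain ⟨L, hL, hLC, hcov⟩ := hgood T k (2 * k / 3) hP0 hPhom (by omega) (by omega)
    (by
      have : 3 ^ T ≤ 2 * k / 3 := by
        rw [Nat.le_div_iff_mul_le (by norm_num)]
        omega
      omega)
  -- per chain: (number of row sets)² · 3^(T·T) ≤ 4^n
  have hB : ∀ C ∈ L, ((∏ j ∈ Finset.range (T + 1), C j).support.image
      fun m => (rowDegrees m).support).card ^ 2 * 3 ^ (T * T) ≤ 4 ^ n := by
    intro C hC
    obtain ⟨⟨K, hK0, hK1, hKc, hKd, hKl, hKn⟩, hsub⟩ := hLC C hC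
    have hbound := container_bound T C (fun j => if j < T then K j - K (j + 1) else K T)
      (fun j hj => by
        rcases Nat.lt_or_eq_of_le hj with hj | rfl
        · simp only [if_pos hj]; exact (hKd j hj).2
        · simp only [lt_irrefl, if_false]; exact hKl)
      hKn (fun m hm => hPml m (hsub hm))
    have hK1' := hK1 (by omega)
    have hKge : ∀ j, 1 ≤ j → j ≤ T → k ≤ 3 ^ j * K j := by
      intro j hj hjT
      induction j with
      | zero => omega
      | succ j ih =>
        rcases Nat.eq_zero_or_pos j with rfl | hjpos
        · rw [zero_add, pow_one]; omega
        · have h1 := (hKc j hjpos (by omega)).2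
          calc k ≤ 3 ^ j * K j := ih hjpos (by omega)
            _ ≤ 3 ^ j * (3 * K (j + 1)) := Nat.mul_le_mul_left _ h1.le
            _ = 3 ^ (j + 1) * K (j + 1) := by ring
    have hdj : ∀ j, j < T → 3 ^ T ≤ K j - K (j + 1) := by
      intro j hj
      have hkey : k ≤ 3 ^ (j + 1) * (K j - K (j + 1)) := by
        rcases Nat.eq_zero_or_pos j with rfl | hjpos
        · rw [zero_add, pow_one, hK0]; omega
        · have h1 := (hKc j hjpos hj).1
          calc k ≤ 3 ^ j * K j := hKge j hjpos hj.le
            _ ≤ 3 ^ j * (3 * (K j - K (j + 1))) := Nat.mul_le_mul_left _ (by omega)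
            _ = 3 ^ (j + 1) * (K j - K (j + 1)) := by ring
      have hpow : 3 ^ (j + 1) * 3 ^ T ≤ k := by
        rw [← pow_add, hk, h9, ← pow_add]
        exact Nat.pow_le_pow_right (by norm_num) (by omega)
      exact Nat.le_of_mul_le_mul_left (hpow.trans hkey) (by positivity)
    have hprod : 3 ^ (T * T) ≤ ∏ j ∈ Finset.range (T + 1),
        ((fun j => if j < T then K j - K (j + 1) else K T) j + 1) := by
      rw [Finset.prod_range_succ]
      refine le_trans ?_ (Nat.le_mul_of_pos_right _ (Nat.succ_pos _))
      calc 3 ^ (T * T) = ∏ _j ∈ Finset.range T, 3 ^ T := by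
            rw [Finset.prod_const, Finset.card_range, ← pow_mul]
        _ ≤ ∏ j ∈ Finset.range T, ((fun j => if j < T then K j - K (j + 1) else K T) j + 1) :=
            Finset.prod_le_prod' fun j hj => by
              have hj' := Finset.mem_range.1 hj
              simp only [if_pos hj']
              exact (hdj j hj').trans (Nat.le_succ _)
    exact le_trans (Nat.mul_le_mul_left _ hprod) hbound
  -- counting the half-size row sets
  have hn1 : 0 < n := by omega
  set img : (ℕ → MvPolynomial (Fin n × Fin n) ℝ≥0) → Finset (Finset (Fin n)) := fun C =>
    (∏ j ∈ Finset.range (T + 1), C j).support.image fun m => (rowDegrees m).support with himg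
  have hcover : Finset.powersetCard k (Finset.univ : Finset (Fin n)) ⊆ L.toFinset.biUnion img := by
    intro S hS
    obtain ⟨m, hm, rfl⟩ := exists_rows_eq k ⟨0, hn1⟩ S (Finset.mem_powersetCard.1 hS).2
    obtain ⟨C, hC, hmC⟩ := hcov m hm
    exact Finset.mem_biUnion.2 ⟨C, List.mem_toFinset.2 hC, Finset.mem_image_of_mem _ hmC⟩
  have hLne : L.toFinset.Nonempty := by
    obtain ⟨m, hm⟩ := support_nonempty.2 hP0
    obtain ⟨C, hC, -⟩ := hcov m hm
    exact ⟨C, List.mem_toFinset.2 hC⟩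
  obtain ⟨Cmax, hCmax, hsup⟩ := Finset.exists_mem_eq_sup L.toFinset hLne fun C => (img C).card
  have hchoose : n.choose k ≤ L.length * (img Cmax).card := by
    calc n.choose k = (Finset.powersetCard k (Finset.univ : Finset (Fin n))).card := by
          rw [Finset.card_powersetCard, Finset.card_univ, Fintype.card_fin]
      _ ≤ (L.toFinset.biUnion img).card := Finset.card_le_card hcover
      _ ≤ ∑ C ∈ L.toFinset, (img C).card := Finset.card_biUnion_le
      _ ≤ L.toFinset.card * (img Cmax).card := by
          have := Finset.sum_le_card_nsmul L.toFinset (fun C => (img C).card) (img Cmax).card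
            (fun C hC => by rw [← hsup]; exact Finset.le_sup (f := fun C => (img C).card) hC)
          simpa using this
      _ ≤ L.length * (img Cmax).card := Nat.mul_le_mul_right _ (List.toFinset_card_le L)
  have hB2 : (img Cmax).card ^ 2 * 3 ^ (T * T) ≤ 4 ^ n := hB Cmax (List.mem_toFinset.1 hCmax)
  -- `4^k ≤ (2k + 1) binom(2k, k)`
  have hcentral : 4 ^ k ≤ (2 * k + 1) * n.choose k := by
    have h := Nat.four_pow_le_two_mul_self_mul_centralBinom k (by omega)
    rw [Nat.centralBinom_eq_two_mul_choose] at h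
    calc 4 ^ k ≤ 2 * k * (2 * k).choose k := h
      _ ≤ (2 * k + 1) * n.choose k := by rw [hn]; exact Nat.mul_le_mul_right _ (by omega)
  -- hence `3^(T·T) ≤ ((2k + 1) |L|)²`
  have hmain : 3 ^ (T * T) ≤ ((2 * k + 1) * L.length) ^ 2 := by
    have h4n : 4 ^ n = (4 ^ k) ^ 2 := by rw [hn, pow_mul']
    have : 4 ^ n * 3 ^ (T * T) ≤ 4 ^ n * ((2 * k + 1) * L.length) ^ 2 := by
      calc 4 ^ n * 3 ^ (T * T) = (4 ^ k) ^ 2 * 3 ^ (T * T) := by rw [h4n]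
        _ ≤ ((2 * k + 1) * n.choose k) ^ 2 * 3 ^ (T * T) :=
            Nat.mul_le_mul_right _ (Nat.pow_le_pow_left hcentral 2)
        _ ≤ ((2 * k + 1) * (L.length * (img Cmax).card)) ^ 2 * 3 ^ (T * T) :=
            Nat.mul_le_mul_right _ (Nat.pow_le_pow_left (Nat.mul_le_mul_left _ hchoose) 2)
        _ = ((2 * k + 1) * L.length) ^ 2 * ((img Cmax).card ^ 2 * 3 ^ (T * T)) := by ring
        _ ≤ ((2 * k + 1) * L.length) ^ 2 * 4 ^ n := Nat.mul_le_mul_left _ hB2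
        _ = 4 ^ n * ((2 * k + 1) * L.length) ^ 2 := by ring
    exact Nat.le_of_mul_le_mul_left this (by positivity)
  -- size estimates: `|L| ≤ 3 (n + 2)^c₀ + 1`, `2k + 1 ≤ n + 2 ≤ 3^(2T + 1)`
  have hn2 : n + 2 ≤ 3 ^ (2 * T + 1) := by
    rw [pow_succ, pow_mul, show (3 : ℕ) ^ 2 = 9 by norm_num, ← hk]
    omega
  have hsmall : ((2 * k + 1) * L.length) ^ 2 < 3 ^ ((2 * T + 1) * (2 * c₀ + 2) + 3) := by
    have h1 : (2 * k + 1) * L.length ≤ (n + 2) * (4 * (n + 2) ^ c₀) := by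
      refine Nat.mul_le_mul (by omega) ?_
      have := Nat.one_le_pow c₀ (n + 2) (by omega)
      omega
    calc ((2 * k + 1) * L.length) ^ 2 ≤ ((n + 2) * (4 * (n + 2) ^ c₀)) ^ 2 :=
          Nat.pow_le_pow_left h1 2
      _ = 16 * (n + 2) ^ (2 * c₀ + 2) := by ring
      _ ≤ 16 * (3 ^ (2 * T + 1)) ^ (2 * c₀ + 2) :=
          Nat.mul_le_mul_left _ (Nat.pow_le_pow_left hn2 _)
      _ < 27 * (3 ^ (2 * T + 1)) ^ (2 * c₀ + 2) :=
          Nat.mul_lt_mul_of_lt_of_le (by norm_num) le_rfl (by positivity)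
      _ = 3 ^ ((2 * T + 1) * (2 * c₀ + 2) + 3) := by
          rw [pow_add (3 : ℕ) ((2 * T + 1) * (2 * c₀ + 2)) 3, pow_mul (3 : ℕ) (2 * T + 1)]
          ring
  have hlt : 3 ^ (T * T) < 3 ^ ((2 * T + 1) * (2 * c₀ + 2) + 3) := lt_of_le_of_lt hmain hsmall
  have hexp := (pow_lt_pow_iff_right₀ (by norm_num : (1 : ℕ) < 3)).1 hlt
  -- but `T² = (2T + 1)(2c₀ + 2) + 3 + (6c₀ + 7)` for `T = 4c₀ + 6`
  have hid : T * T = (2 * T + 1) * (2 * c₀ + 2) + 3 + (6 * c₀ + 7) := by rw [hT]; ring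
  omega

end Summit.ValiantsHypothesis.ValiantsHypothesis.Theorems

end
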